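import Summits.CriticalPhenomena.PercolationContinuityZ3.Theorems.Transplant.BoxProdZ2ConcRealised
import Summits.CriticalPhenomena.PercolationContinuityZ3.Theorems.Transplant.KNCells2Cover
import Summits.CriticalPhenomena.PercolationContinuityZ3.Theorems.Transplant.KNCells2RunInv
import HarnessLib

/-!
# Design (D), residue (C): ALONG A RUN every explored vertex adjacent to the fresh corridor world `E_{v,x} ∪ H_{x,y}` of the chosen probe
# `(v → x)` is FIBRE-DEEP — radius `≤ E(nS α v)`, the radius of `v`'s own cube and stubs (the `hdeep` input of `real_rim_le_concG`)

builds on p205010 (kernel theorem, internal audit signed; external expert review pending) — nothing in this file uses p205010.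
Lane `prim-bschramm`, seat `prim-bschramm-p5` (gen 3, refuter; holder of residue (C); lead ruling 15:35:49Z (vi)), helper file
(`--supports stmt-CriticalPhenomena-4575`).

By `RunInv₂.V_cases` an explored vertex `a` of the run history `hst₂ ω n` lies in the root cube or in the new region of an earlier chosen
valid probe `e' = (w → u)` (its `E_{w,u}` at the arrival anchor and the stubs of `u` at the departure anchor).  THE LINEAGE (`u = v`): the
departure anchor of that probe is `v`'s arrival anchor now (`anchors_tgt_of_probe₂`), so by `Realised.nS_eq` the whole new region has fibre
radius `≤ E(nS α v)` — no planar input.  OTHERWISE `u ∉ {v, x, y}` and `w ∉ {x, y}` (`x` is the undetermined candidate, `y = x + du` has an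
unexplored column, `u`, `w` are determined), and the three PLANAR SEPARATION facts (hypotheses `hSQ`, `hSB`, `hSS`; p3-g2's `PlanarCellsPSep3`)
forbid any `X □ ℤ²`-edge between the new region and the world.
* `not_adj_of_sep` — planar `Sep` of the footprints forbids adjacency in `X □ ℤ²`;
* **`deep_of_run`**.
[cite: KozmaNitzan2024, §4 pp. 26–27 ((29), E_{i+1}), p. 31]
-/

noncomputable section

open MeasureTheory ProbabilityTheory
open scoped ENNReal Classical

namespace Summit.CriticalPhenomena.PercolationContinuityZ3.Theorems

namespace Transplant

namespace BoxProdZ2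

open Literature.Probability.Percolation Literature.Probability.LatticeModels SimpleGraph GadgetSystem ProbeHistory HSiteScheme Contour KNCells
open Literature.Barriers.CriticalPhenomena (mem_graphBall_self)

variable {W : Type} [DecidableEq W] (X : SimpleGraph W) [X.LocallyFinite]

omit [DecidableEq W] [X.LocallyFinite] in
/-- Planar separation of the footprints forbids adjacency in `X □ ℤ²`. [folklore] -/
theorem not_adj_of_sep {A B : Finset (Site 2)} (h : KozmaNitzan.Sep (↑A : Set (Site 2)) ↑B) {a b : W × Site 2} (ha : a.2 ∈ A)
    (hb : b.2 ∈ B) : ¬(X □ zdGraph 2).Adj a b := by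
  intro hadj
  obtain ⟨hne, hnadj⟩ := h a.2 (Finset.mem_coe.2 ha) b.2 (Finset.mem_coe.2 hb)
  rcases boxProd_adj.1 hadj with ⟨-, h2⟩ | ⟨h2, -⟩
  · exact hne h2
  · exact hnadj h2

/-- **Deep entrances along a run.**  For the run history `h = hst₂ ω n` of the concentric scheme with schedule `concRadiiGB C gap gap' E₀ L'`,
its chosen candidate `e = (v, δ)` and an onward direction `du` of `x = tgt e`: every explored vertex adjacent to a vertex of
`E_{v,x} ∪ H_{x, x+du}` has fibre radius `≤ E(nS α v)`, `α = aOf₁ h e` — given the planar separation of the world from the cubes, between-boxes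
and stubs of the macro-vertices off the lineage. [cite: KozmaNitzan2024, §4 pp. 26–27, 31] -/
theorem deep_of_run [Countable W] (C : PCells) (w₀ : W) (gap gap' : ℕ → ℕ) (E₀ L' : ℕ) (q : unitInterval) (δc : ℝ)
    (hSQ : ∀ (v : Site 2) (δ du : MDir) (u : Site 2), v + stepVec δ + stepVec du ≠ v → u ≠ v → u ≠ v + stepVec δ →
      u ≠ v + stepVec δ + stepVec du →
      KozmaNitzan.Sep (↑(C.Q u) : Set (Site 2)) ↑(C.Btw v δ ∪ C.Q (v + stepVec δ) ∪ C.Hfull (v + stepVec δ) du))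
    (hSB : ∀ (v : Site 2) (δ du : MDir) (w : Site 2) (δ' : MDir), v + stepVec δ + stepVec du ≠ v → w ≠ v + stepVec δ →
      w ≠ v + stepVec δ + stepVec du → w + stepVec δ' ≠ v → w + stepVec δ' ≠ v + stepVec δ → w + stepVec δ' ≠ v + stepVec δ + stepVec du →
      KozmaNitzan.Sep (↑(C.Btw w δ') : Set (Site 2)) ↑(C.Btw v δ ∪ C.Q (v + stepVec δ) ∪ C.Hfull (v + stepVec δ) du))
    (hSS : ∀ (v : Site 2) (δ du : MDir) (u : Site 2) (du' : MDir) (j : ℕ), v + stepVec δ + stepVec du ≠ v → u ≠ v → u ≠ v + stepVec δ →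
      u ≠ v + stepVec δ + stepVec du → j + 1 ≤ C.K →
      KozmaNitzan.Sep (↑(C.Stub u du' j) : Set (Site 2)) ↑(C.Btw v δ ∪ C.Q (v + stepVec δ) ∪ C.Hfull (v + stepVec δ) du))
    (ω : BondConfig (W × Site 2)) (n : ℕ) {e : Site 2 × MDir}
    (hc : (((concSchemeG X C w₀ (concRadiiGB C gap gap' E₀ L') q δc).scheme₂ (X □ zdGraph 2)).stN n ω).choice = some e) {du : MDir}
    (hdu : du ∈ (concSchemeG X C w₀ (concRadiiGB C gap gap' E₀ L') q δc).onward (X □ zdGraph 2)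
      ((concSchemeG X C w₀ (concRadiiGB C gap gap' E₀ L') q δc).hst₂ (X □ zdGraph 2) ω n) (tgt e)) (a' : ℕ) :
    ∀ a ∈ (concSchemeG X C w₀ (concRadiiGB C gap gap' E₀ L') q δc).Vx (X □ zdGraph 2)
        ((concSchemeG X C w₀ (concRadiiGB C gap gap' E₀ L') q δc).hst₂ (X □ zdGraph 2) ω n),
      ∀ b ∈ (concSchemeG X C w₀ (concRadiiGB C gap gap' E₀ L') q δc).Γ.Ewv
          ((concSchemeG X C w₀ (concRadiiGB C gap gap' E₀ L') q δc).aOf₁ (X □ zdGraph 2)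
            ((concSchemeG X C w₀ (concRadiiGB C gap gap' E₀ L') q δc).hst₂ (X □ zdGraph 2) ω n) e) e.1 e.2 ∪
        (faceDataCG X C w₀ (concRadiiGB C gap gap' E₀ L')).Hfull a' (tgt e) du,
      b ∉ (concSchemeG X C w₀ (concRadiiGB C gap gap' E₀ L') q δc).Vx (X □ zdGraph 2)
          ((concSchemeG X C w₀ (concRadiiGB C gap gap' E₀ L') q δc).hst₂ (X □ zdGraph 2) ω n) →
      (X □ zdGraph 2).Adj a b →
      a.1 ∈ ballFin X w₀ (Erad gap gap' E₀ (nS ((concSchemeG X C w₀ (concRadiiGB C gap gap' E₀ L') q δc).aOf₁ (X □ zdGraph 2)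
        ((concSchemeG X C w₀ (concRadiiGB C gap gap' E₀ L') q δc).hst₂ (X □ zdGraph 2) ω n) e) e.1)) := by
  -- abbreviations
  set Λ := concRadiiGB C gap gap' E₀ L' with hΛdef
  set S := concSchemeG X C w₀ Λ q δc with hSdef
  set G := X □ zdGraph 2 with hGdef
  set h := S.hst₂ G ω n with hhdef
  set α := S.aOf₁ G h e with hαdef
  have hΓ : S.Γ = cellGeomCG X C w₀ Λ := rfl
  have hI : S.RunInv₂ G ω n := KSchA.runInv₂ (runGeomCG X C w₀) (anchGeomCG X C w₀) ω n
  set v := e.1 with hvdef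
  set x := tgt e with hxdef
  set y := tgt e + stepVec du with hydef
  have hxv : x = v + stepVec e.2 := rfl
  -- `x` is undetermined, `y` has an unexplored column, `v` is occupied
  have hcand := HState.cand_of_choice hc
  have hxndet : ¬((S.scheme₂ G).stN n ω).Det x := hcand.2
  have hcol : ∀ z ∈ S.Vx G h, z.2 ≠ C.cen y := fun z hz hz2 => (Finset.mem_filter.1 hdu).2 z hz hz2
  have hyndet : ¬((S.scheme₂ G).stN n ω).Det y := by
    intro hdet
    obtain ⟨a₁, hQ⟩ := hI.det_Q y hdet
    have hmem : ((w₀, C.cen y) : W × Site 2) ∈ S.Γ.Q a₁ y :=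
      Finset.mem_product.2 ⟨(mem_ballFin X).2 (mem_graphBall_self X w₀ _), C.cen_mem_Q y⟩
    exact hcol _ (hQ hmem) rfl
  have hvdet : ((S.scheme₂ G).stN n ω).Det v := Or.inl hcand.1
  have hyv : v + stepVec e.2 + stepVec du ≠ v := fun hh => hyndet (by rw [show y = v + stepVec e.2 + stepVec du from rfl, hh]; exact hvdet)
  intro a ha b hb _ hadj
  -- planar footprint of `b`
  have hb2 : b.2 ∈ C.Btw v e.2 ∪ C.Q (v + stepVec e.2) ∪ C.Hfull (v + stepVec e.2) du := by
    rcases Finset.mem_union.1 hb with hb | hb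
    · change b ∈ S.Γ.Btw α e.1 e.2 ∪ S.Γ.Q α (e.1 + stepVec e.2) at hb
      rcases Finset.mem_union.1 hb with hb | hb
      · exact Finset.mem_union_left _ (Finset.mem_union_left _ (Finset.mem_product.1 hb).2)
      · exact Finset.mem_union_left _ (Finset.mem_union_right _ (Finset.mem_product.1 hb).2)
    · change b ∈ stair X w₀ (fun t => Λ.ρ a' (tgt e) du (C.lev du (tgt e) t)) (C.Hfull (tgt e) du) at hb
      rw [mem_stair] at hb
      exact Finset.mem_union_right _ hb.1
  rcases hI.V_cases a ha with haQ | ⟨m, hm, e', hc', hV', hD', ha'⟩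
  · -- the root cube: radius `E₀ = E 0 ≤ E (nS α v)`
    have ha1 : a.1 ∈ ballFin X w₀ (Λ.rQ S.Γ.a₀ 0) := (Finset.mem_product.1 haQ).1
    refine ballFin_mono X w₀ ?_ ha1
    change Erad gap gap' E₀ (nQ 0 0) ≤ _
    exact Erad_mono gap gap' E₀ (by simp [nQ])
  · -- an earlier probe `e' = (w → u)`
    set h' := S.hst₂ G ω m with hh'def
    set α' := S.aOf₁ G h' e' with hα'def
    set β' := S.aOf₂ G h' e' with hβ'def
    set u := tgt e' with hudef
    have hc'' : (S.astOf₂ G h').st.choice = some e' := by rw [← S.stN_eq₂]; exact hc'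
    have hreal : Realised α' β' u := realised_of_choice h' hc''
    have hudet : ((S.scheme₂ G).stN n ω).Det u := KSchA.det_tgt_of_probe₂ hm hc' hD'
    have hwdet : ((S.scheme₂ G).stN n ω).Det e'.1 :=
      (S.scheme₂ G).det_stN_mono ω hm.le (Or.inl (HState.cand_of_choice hc').1)
    -- membership of `a` in the new region of `e'`
    have ha'' : a ∈ S.Γ.Ewv α' e'.1 e'.2 ∪ (S.onward G h' u).biUnion fun d => S.Γ.Stub β' u d (S.jOf G h' e' α' β' d (S.oOf₂ G ω h' e')) :=
      ha'
    by_cases huv : u = v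
    · -- THE LINEAGE: radius `E (nQ α' u) = E (nS β' u) = E (nS α v)`
      have harr : (S.astOf₂ G h).arr u = β' := (KSchA.anchors_tgt_of_probe₂ hm hc' hD').1
      have hαβ : α = β' := by
        rw [hαdef, KSchA.aOf₁]
        show (S.astOf₂ G h).arr v = β'
        rw [← huv]; exact harr
      have hE : Erad gap gap' E₀ (nQ α' u) = Erad gap gap' E₀ (nS α v) := by rw [hαβ, ← huv, hreal.nS_eq]
      rcases Finset.mem_union.1 ha'' with ha3 | ha3
      · change a ∈ S.Γ.Btw α' e'.1 e'.2 ∪ S.Γ.Q α' (e'.1 + stepVec e'.2) at ha3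
        rcases Finset.mem_union.1 ha3 with ha3 | ha3
        · have ha1 : a.1 ∈ ballFin X w₀ (Λ.rB α' e'.1 e'.2) := (Finset.mem_product.1 ha3).1
          rw [← hE]
          refine ballFin_mono X w₀ ?_ ha1
          rw [concRadiiGB_rB, concRadiiGB_rE]
          exact min_le_right _ _
        · have ha1 : a.1 ∈ ballFin X w₀ (Λ.rQ α' (e'.1 + stepVec e'.2)) := (Finset.mem_product.1 ha3).1
          rw [← hE]
          exact ha1
      · obtain ⟨d, -, ha4⟩ := Finset.mem_biUnion.1 ha3
        change a ∈ stair X w₀ (fun t => Λ.ρ β' u d (C.lev d u t)) (C.Stub u d _) at ha4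
        rw [mem_stair] at ha4
        refine ballFin_mono X w₀ ?_ ha4.2
        rw [hαβ, ← huv, concRadiiGB_ρ]
        exact ρ_le C gap gap' E₀ L' β' u d _
    · -- OFF THE LINEAGE: planar separation forbids the edge
      exfalso
      have hux : u ≠ v + stepVec e.2 := fun hh => hxndet (by rw [hxv, ← hh]; exact hudet)
      have huy : u ≠ v + stepVec e.2 + stepVec du := fun hh => hyndet (by rw [show y = v + stepVec e.2 + stepVec du from rfl, ← hh]; exact hudet)
      have hwx : e'.1 ≠ v + stepVec e.2 := fun hh => hxndet (by rw [hxv, ← hh]; exact hwdet)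
      have hwy : e'.1 ≠ v + stepVec e.2 + stepVec du := fun hh =>
        hyndet (by rw [show y = v + stepVec e.2 + stepVec du from rfl, ← hh]; exact hwdet)
      rcases Finset.mem_union.1 ha'' with ha3 | ha3
      · change a ∈ S.Γ.Btw α' e'.1 e'.2 ∪ S.Γ.Q α' (e'.1 + stepVec e'.2) at ha3
        rcases Finset.mem_union.1 ha3 with ha3 | ha3
        · have ha2 : a.2 ∈ C.Btw e'.1 e'.2 := (Finset.mem_product.1 ha3).2
          have hwv : e'.1 + stepVec e'.2 ≠ v := huv
          exact not_adj_of_sep X (hSB v e.2 du e'.1 e'.2 hyv hwx hwy hwv hux huy) ha2 hb2 hadj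
        · have ha2 : a.2 ∈ C.Q u := (Finset.mem_product.1 ha3).2
          exact not_adj_of_sep X (hSQ v e.2 du u hyv huv hux huy) ha2 hb2 hadj
      · obtain ⟨d, -, ha4⟩ := Finset.mem_biUnion.1 ha3
        change a ∈ stair X w₀ (fun t => Λ.ρ β' u d (C.lev d u t)) (C.Stub u d _) at ha4
        rw [mem_stair] at ha4
        have hj : S.jOf G h' e' α' β' d (S.oOf₂ G ω h' e') + 1 ≤ C.K := S.jOf_lt h' e' α' β' d _
        exact not_adj_of_sep X (hSS v e.2 du u d _ hyv huv hux huy hj) ha4.1 hb2 hadj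

end BoxProdZ2

end Transplant

end Summit.CriticalPhenomena.PercolationContinuityZ3.Theorems

end
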